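import Summits.ABC.IUTFork.Repair.RHOffSigmaToleranceExponent
import Literature.NumberTheory.DiophantineGeometry.GenEllThm21WithTriples
import HarnessLib

/-!
# R-H ROUND 2, Q1 (rows 3/4/5; seat abc-iut-rh2-xi-1): the MULTIPLICATIVE abc-tolerance of the off-Σ remainder, VII — THE EXPONENT CLASS, part 4
# (F° ∩ R19): the `K_V`-free degree-one line bounds `log (abc)_{odd}`, so the DILATED display `1/6 ↦ μ/6` at the rational points gives abc WITH
# EXPONENT `1/μ` (not `3/μ`) ON EVERY FAR-FROM-CUSPS FAMILY — transfer-free and cone-free — in the EXP programme's currency (`GenEllThm21With`, F1)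

PROOF-ONLY sequel (no `def`, no new `Prop`, no instance, no notation; nothing re-typed) of this seat's `RHOffSigmaToleranceExponent.lean` (p481071:
`log_le_of_dilatedDisplay_degOne`, `c < C_ε·rad^{3/μ+ε}`), of abc-iut-S6's `ThetaPartIIDegOne.arith_core` (whose conclusion is about `X = log (abc)_{odd}`:
`μ·X ≤ 3(1+ε)·R + K₀`), of abc-iut-rh-typ-7's EXP F1 `GenEllThm21With.lean` (p482093: `ABCWithExponentOn K Λ`, §4 far-from-cusps families, §5 / R19
the EXPONENT RIGIDITY of the Belyi transfer) and of `GenEllThm21WithTriples.lean` (`farFromCusps_ratPoint_triple_iff`: `λ = a/c` is `ρ`-far from the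
cusps at `∞` and `2` iff `ρ·c < a`, `ρ·c < b`, `ρ ≤ |a|_2, |b|_2, |c|_2`). Rung LADDER-ABC:A2.RESCUE.H, R-H round 2 EXPONENT PROGRAMME (EXP-SPEC v0.1 §2 F°
«cone-free degree-one companion»; §7 R19: conclusion of record = «abc with exponent `1/μ₀` ON every far-from-cusps family», shape (a)). TAKES NO SIDE on
[IUTchIII] Cor. 3.12 or on any author; typed ≠ proved; instantiated ≠ endorsed.

THE POINT. The factor `3` of F° is the `K_V`-free price `2·log (abc)_{odd} ≤ log(q^{∤2})`, `c ≤ 2·(abc)_{odd}`; but print's arithmetic bounds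
`X = log (abc)_{odd}` itself: `X ≤ (3/μ)(1+ε)·log rad + C_ε` (§1). On a far-from-cusps family (`min(a, b) > ρ·c`, `2^{v₂(a)}, 2^{v₂(b)}, 2^{v₂(c)} ≤ ρ⁻¹`)
`ρ⁵·c³ ≤ (abc)_{odd}` (§2), hence `log c ≤ (1/μ)(1+ε)·log rad + C(ρ, ε)`: **abc with exponent `1/μ` on every far-from-cusps family** (§3) — R19's shape (a)
with `Λ = 1/μ`, at DEGREE ONE, with NO compactly bounded subset, NO Cor. 2.2 (i) discrepancy classes, NO `PartIIWith` port, NO Belyi map, NO cone binder.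
* §1 `log_oddPart_le_of_dilatedDisplay_degOne` — `∃ C, ∀ abc, log (abc)_{odd} ≤ (3/μ)(1+ε)·log rad(abc) + C` (`0 < μ ≤ 1`, `0 < ε ≤ 1`; p481071's proof
  verbatim up to its last step);
* §2 `natCast_ordCompl_two_eq_mul_padicNorm` (`(n)_{odd} = n·|n|_2`), `rho_pow_five_mul_cube_le_oddPart_of_farFromCusps` (`ρ⁵·c³ ≤ (abc)_{odd}`);
* §3 **`abcExpOn_farFromCusps_of_dilatedDisplay_degOne`** — `∀ ρ ∈ (0, 1/2], ABCWithExponentOn {P | P.FarFromCusps {2} ρ} (1/μ)`.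
The all-triples currency `ABCWithExponent (3/μ)` and the door-level corollaries (this seat's `OffSigmaTolerance κ Tol` / licensed share `μ` at the
Szpiro-bad rational data, `μ = 1 − κ`) are the sequel `RHOffSigmaToleranceExponentFarDoor.lean`.
READING (numbers, not adjectives): at the uniform label cut `κ = 1/2` (R18: `μ₀ = 1/8`) the degree-one door gives exponent `8` on every far-from-cusps
family (`24` on all triples); `1/μ₄ ≤ 3.26` (frey bed) ↦ `3.26`; HEX `1.49` ↦ `1.49` — IF those shares held at every height (no table says so). NOT here:
one constant serving every `ρ` (= `ABCWithExponent (1/μ)` on all triples, by `GenEll.abcWithExponent_iff_abcWithExponentOn_exists_far` exactly the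
uniformity the exponent-rigid Belyi transfer does not supply at `Λ > 1`, R19). HONEST SCOPE: CONDITIONAL on the dilated-display binder; nothing here
asserts that abc (with any exponent, on any family) is proved or refuted, or that Thm. 1.10's display (dilated or not) holds at any datum; no side
taken; typed ≠ proved; computed ≠ proved; instantiated ≠ endorsed.
[cite: Mochizuki2012, IUTchIV Thm. 1.10 pp. 22–31; Cor. 2.2 (ii) pp. 41–48] [cite: MochizukiGenEll2010, Ex 1.3 (ii) p.5; Thm 2.1 p.11–13]
[claim: Mochizuki2012, status: disputed]
Axioms: standard.
-/

noncomputable section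

namespace Summit.ABC.IUTFork.Repair.RH.OffSigma

open Literature.IUT.LogVolume Literature.IUT.LogVolume.Cor22
open Literature.NumberTheory.DiophantineGeometry Literature.NumberTheory.DiophantineGeometry.GenEll
open Summit.ABC.ABC.Theorems Summit.ABC.ABC.Theorems.ThetaPartIIDegOne
open NumberField IsDedekindDomain Real

/-! ## §1 The `K_V`-free degree-one line bounds `log (abc)_{odd}` -/

/-- **The DILATED display at the rational points implies `log (abc)_{odd} ≤ (3/μ)·(1+ε)·log rad(abc) + C_ε` for every `0 < ε ≤ 1` and EVERY abc
triple** (`0 < μ ≤ 1`; `(abc)_{odd} = ordCompl[2] (abc)`): the proof of p481071's `log_le_of_dilatedDisplay_degOne` VERBATIM ([IUTchIV] Cor. 2.2 (ii) pp. 43–48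
at `λ = a/c`, `arith_core` on `μ·X`, `μ·log(q)`, `μ·h`), stopped one step earlier — print's arithmetic bounds `X = log (abc)_{odd}` (the quantity with
`2X ≤ log(q^{∤2}(λ))`, `Cor22.two_mul_log_oddPart_le_logQNotTwo`), of which `log c ≤ X + log 2` is only the all-triples shadow. CONDITIONAL on `hdisp`;
no side taken. [cite: Mochizuki2012, IUTchIV Cor. 2.2 (ii) proof pp. 43–48] [claim: Mochizuki2012, status: disputed] -/
theorem log_oddPart_le_of_dilatedDisplay_degOne {μ : ℝ} (hμ0 : 0 < μ) (hμ1 : μ ≤ 1)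
    (hdisp : ∀ η : ℝ, IsEtaPrm η → ∀ P : NFPoint, P ∈ UP → P.degree ≤ 1 → ∀ l : ℕ, l.Prime → 5 ≤ l →
      AdmitsCore P → CondP2 P l → CondP5 P l → CondP6 P l →
      1 / 6 * (μ * logQAvoid P {2, l}) ≤
        (1 + 20 * (dmod P : ℝ) / l) * (P.logDiff + logCondAvoid P {2, l})
          + 20 * (2 ^ 12 * 3 ^ 3 * 5 * (dmod P : ℝ) * l + η))
    {ε : ℝ} (hε : 0 < ε) (hε1 : ε ≤ 1) :
    ∃ C : ℝ, ∀ a b c : ℕ, IsABCTriple a b c →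
      Real.log ((ordCompl[2] (a * b * c) : ℕ) : ℝ) ≤ 3 / μ * (1 + ε) * Real.log (rad a b c) + C := by
  classical
  obtain ⟨ξ, hξ⟩ := exists_isXiPrm
  have hξ5 : 5 ≤ ξ := hξ.1
  obtain ⟨η, hη⟩ := exists_isEtaPrm
  have hη0 : 0 < η := hη.1
  obtain ⟨G₀, hG₀⟩ := condP6_ratPoint_triple
  obtain ⟨H₃, hH₃0, hH₃⟩ := exists_threshold_sixtyDeltaSq_log_div_sqrt_le
  set ε₁ : ℝ := ε * μ / 6 with hε₁def
  have hε₁0 : 0 < ε₁ := by positivity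
  have hε₁1 : ε₁ ≤ 1 := by
    rw [hε₁def]
    have : ε * μ ≤ 1 * 1 := mul_le_mul hε1 hμ1 hμ0.le (by norm_num)
    linarith
  obtain ⟨Hthr, hHthr⟩ : ∃ Hthr : ℝ, Hthr = H₃ * ε₁ ^ (-(3 : ℝ)) * (1 : ℝ) ^ (-(3 : ℝ)) * ((1 : ℕ) : ℝ) ^ (4 + (1 : ℝ)) :=
    ⟨_, rfl⟩
  obtain ⟨δ, hδdef⟩ : ∃ δ : ℝ, δ = delta 1 := ⟨_, rfl⟩
  have hδv : δ = 552960 := by rw [hδdef]; unfold delta; norm_num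
  have hδ2 : 2 ≤ δ := by rw [hδv]; norm_num
  set H₁ : ℝ := ξ ^ 2 + 50 + max G₀ 0 + max Hthr 0 + (80 / ε) ^ 2 + (91 + 6 * δ) ^ 4 with hH₁
  have hG0 : 0 ≤ max G₀ 0 := le_max_right _ _
  have hT0 : 0 ≤ max Hthr 0 := le_max_right _ _
  have hε80 : 0 ≤ (80 / ε) ^ 2 := sq_nonneg _
  have h43 : 0 ≤ (91 + 6 * δ) ^ 4 := by positivity
  have hξ0 : 0 ≤ ξ ^ 2 := sq_nonneg _
  have hH₁0 : 0 ≤ H₁ := by rw [hH₁]; positivity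
  have hlog2 : Real.log 2 ≤ 1 := by have := Real.log_two_lt_d9; linarith
  have hK0 : 0 ≤ (5 * (ε / 6) + 120 * η) / μ := by positivity
  refine ⟨H₁ / 2 + (5 * (ε / 6) + 120 * η) / μ, fun a b c ht => ?_⟩
  obtain ⟨P, hP⟩ : ∃ P : NFPoint, P = ratPoint ((a : ℚ) / c) := ⟨_, rfl⟩
  have hmem : P ∈ UPle 1 := by rw [hP]; exact ratPoint_triple_mem ht
  have hPU : P ∈ UP := hmem.1
  have hdeg : P.degree ≤ 1 := hmem.2
  have hInU : P.InU := hPU.1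
  have hcpos : 0 < c := by have := ht.2.2.1; have := ht.1; omega
  have hc0 : (0 : ℝ) < c := by exact_mod_cast hcpos
  obtain ⟨X, hX⟩ : ∃ X : ℝ, X = Real.log (ordCompl[2] (a * b * c) : ℕ) := ⟨_, rfl⟩
  obtain ⟨h, hh⟩ : ∃ h : ℝ, h = logQForall P := ⟨_, rfl⟩
  obtain ⟨R, hR⟩ : ∃ R : ℝ, R = Real.log (rad a b c) := ⟨_, rfl⟩
  have hR0 : 0 ≤ R := by
    have : 0 < rad a b c := by rw [rad_def]; exact Nat.pos_of_ne_zero UniqueFactorizationMonoid.radical_ne_zero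
    rw [hR]; exact Real.log_nonneg (by exact_mod_cast this)
  have hX2 : 2 * X ≤ logQNotTwo P := by rw [hX, hP]; exact two_mul_log_oddPart_le_logQNotTwo ht
  have hq2h : logQNotTwo P ≤ h := by rw [hh]; exact logQAvoid_anti P (Finset.empty_subset _)
  have hhht : h ≤ htInfty P := by rw [hh]; exact logQForall_le_htInfty P
  have hht : htInfty P ≤ 6 * Real.log c + Real.log 256 := by rw [hP]; exact htInfty_ratPoint_triple_le ht
  have hc2 : (c : ℝ) ≤ 2 * (ordCompl[2] (a * b * c) : ℕ) := natCast_le_two_mul_oddPart ht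
  have hodd0 : (0 : ℝ) < (ordCompl[2] (a * b * c) : ℕ) := by linarith
  have hlogc : Real.log c ≤ X + Real.log 2 := by
    rw [hX, add_comm, ← Real.log_mul (by norm_num) hodd0.ne']
    exact Real.log_le_log hc0 hc2
  have hlog256 : Real.log 256 = 8 * Real.log 2 := by
    rw [show (256 : ℝ) = 2 ^ 8 by norm_num, Real.log_pow]; norm_num
  have hh6 : h ≤ 6 * X + 10 := by
    have := Real.log_two_lt_d9
    rw [hlog256] at hht
    linarith
  have hh0 : 0 ≤ h := by rw [hh]; exact logQAvoid_nonneg P ∅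
  have hmain0 : 0 ≤ 3 / μ * (1 + ε) * R := mul_nonneg (mul_nonneg (by positivity) (by linarith)) hR0
  by_cases hcase : h ≤ H₁
  · have h1 : X ≤ H₁ / 2 := by linarith
    rw [← hR, ← hX]
    linarith
  rw [not_le] at hcase
  obtain ⟨s, hs⟩ : ∃ s : ℝ, s = Real.sqrt h := ⟨_, rfl⟩
  have hs2 : s ^ 2 = h := by rw [hs]; exact Real.sq_sqrt hh0
  have hs0 : 0 ≤ s := by rw [hs]; exact Real.sqrt_nonneg h
  have hξs : ξ ≤ s := by
    rw [hs]
    calc ξ = Real.sqrt (ξ ^ 2) := (Real.sqrt_sq (by linarith)).symm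
      _ ≤ Real.sqrt h := Real.sqrt_le_sqrt (by linarith)
  have h5s : 5 ≤ s := le_trans hξ5 hξs
  have hspos : 0 < s := by linarith
  have h7s : 7 < s := by
    rw [hs, Real.lt_sqrt (by norm_num)]; linarith
  have h80s : 80 / ε ≤ s := by
    rw [hs]
    calc 80 / ε = Real.sqrt ((80 / ε) ^ 2) := (Real.sqrt_sq (by positivity)).symm
      _ ≤ Real.sqrt h := Real.sqrt_le_sqrt (by linarith)
  have hcore : AdmitsCore P := by
    by_contra hno
    have := logQForall_le_of_not_admitsCore hno
    rw [← hh] at this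
    linarith
  obtain ⟨l, hlp, hP1lo, hP1hi, hP2', hP3⟩ :=
    exists_prime_P1_P2_P3_point P hdeg hξ (by rw [hs, hh] at hξs; exact hξs)
  have hP1lo' : s ≤ l := by rw [hs, hh]; exact hP1lo
  have hP1hi' : (l : ℝ) ≤ 10 * δ * s * Real.log (2 * δ * s ^ 2) := by
    rw [hs2, hδdef, hs, hh]; exact hP1hi
  have hl7 : 7 ≤ l := by
    have : (7 : ℝ) < l := lt_of_lt_of_le h7s hP1lo'
    exact_mod_cast this.le
  have hl5 : 5 ≤ l := le_trans (by norm_num) hl7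
  have hl0 : (0 : ℝ) < l := by exact_mod_cast hlp.pos
  have hl1 : (1 : ℝ) ≤ l := by exact_mod_cast hlp.one_lt.le
  have hlR5 : (5 : ℝ) ≤ l := by exact_mod_cast hl5
  haveI : Fact l.Prime := ⟨hlp⟩
  have hQ1 : logQNotTwo P - logQAvoid P {2, l} ≤ s * Real.log l :=
    logQNotTwo_sub_logQAvoid_le P hlp hs0 (fun v hv hres => by
      have := hP3 v hv hres; rw [hs, hh]; exact this.le)
  have hl_le : (l : ℝ) ≤ 20 * δ ^ 2 * s ^ 4 := l_le_of_P1 h5s hδ2 hP1hi'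
  have hP5 : CondP5 P l := by
    by_contra hno
    have hq0 : logQAvoid P {2, l} = 0 := logQAvoid_pair_eq_zero_of_not_condP5 hno
    have hmain : s ^ 2 ≤ 10 + 3 * s * Real.log l := by rw [hs2]; linarith
    have hb := sq_le_of_le_add_mul_log h5s hδ2 (by norm_num : (0 : ℝ) ≤ 10) hlR5 hl_le hmain
    rw [hs2] at hb
    have e : (10 + 81 + 6 * δ : ℝ) ^ 4 = (91 + 6 * δ) ^ 4 := by norm_num
    linarith
  have hP6 : CondP6 P l := by
    rw [hP] at hP2' hP5 ⊢
    refine hG₀ a b c ht l hlp hl7 hP2' hP5 ?_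
    have := le_max_left G₀ 0
    rw [← hP, ← hh]
    linarith
  have hdispP := hdisp η hη P hPU hdeg l hlp hl5 hcore hP2' hP5 hP6
  have hLD : P.logDiff = 0 := by rw [hP]; exact logDiff_ratPoint _
  have hLc : logCondAvoid P {2, l} ≤ R := by
    rw [hR, ← logCond_ratPoint_triple ht]
    have := logCondAvoid_le_logCond P hInU {2, l}
    rw [hP] at this ⊢
    exact this
  have hd2 : 1 / 6 * (μ * logQAvoid P {2, l}) ≤
      (1 + 20 / (l : ℝ)) * logCondAvoid P {2, l} + 20 * (552960 * l + η) := by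
    have hd := hdispP
    have e1 : ((dmod P : ℕ) : ℝ) = 1 := by rw [dmod_eq_one_of_degree_le_one hdeg]; simp
    rw [e1, hLD] at hd
    have e : (1 + 20 * (1 : ℝ) / l) * (0 + logCondAvoid P {2, l}) + 20 * (2 ^ 12 * 3 ^ 3 * 5 * (1 : ℝ) * l + η)
        = (1 + 20 / (l : ℝ)) * logCondAvoid P {2, l} + 20 * (552960 * l + η) := by ring
    rw [← e]; exact hd
  have h20 : 20 / (l : ℝ) ≤ ε / 4 := by
    have h80l : 80 / ε ≤ l := le_trans h80s hP1lo'
    rw [div_le_iff₀ hε] at h80l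
    rw [div_le_iff₀ hl0]
    linarith
  obtain ⟨Λ, hΛ⟩ : ∃ Λ : ℝ, Λ = Real.log (2 * δ * h) := ⟨_, rfl⟩
  have hH₁50 : 50 ≤ H₁ := by rw [hH₁]; linarith
  have h2δh : 1 < 2 * δ * h := by rw [hδv]; linarith
  have hΛ0 : 0 ≤ Λ := by rw [hΛ]; exact Real.log_nonneg h2δh.le
  obtain ⟨W, hW⟩ : ∃ W : ℝ, W = s * Λ := ⟨_, rfl⟩
  have hW0 : 0 ≤ W := by rw [hW]; exact mul_nonneg hs0 hΛ0
  have hlW : (l : ℝ) ≤ 10 * 552960 * W := by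
    calc (l : ℝ) ≤ 10 * δ * s * Real.log (2 * δ * s ^ 2) := hP1hi'
      _ = 10 * 552960 * W := by rw [hW, hΛ, ← hs2, hδv]; ring
  have hlogl : Real.log l ≤ 3 * Λ := by
    have hle : (l : ℝ) ≤ (2 * δ * h) ^ 3 := by
      have e1 : 20 * δ ^ 2 * s ^ 4 = 20 * δ ^ 2 * h ^ 2 := by rw [← hs2]; ring
      rw [e1] at hl_le
      have hk : 0 ≤ δ ^ 2 * h ^ 2 * (8 * δ * h - 20) :=
        mul_nonneg (by positivity) (by rw [hδv]; linarith)
      have e2 : δ ^ 2 * h ^ 2 * (8 * δ * h - 20) = 8 * (δ ^ 3 * h ^ 3) - 20 * (δ ^ 2 * h ^ 2) := by ring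
      have e3 : (2 * δ * h) ^ 3 = 8 * (δ ^ 3 * h ^ 3) := by ring
      rw [e2] at hk
      rw [e3]
      linarith
    calc Real.log l ≤ Real.log ((2 * δ * h) ^ 3) := Real.log_le_log hl0 hle
      _ = 3 * Λ := by rw [Real.log_pow, hΛ]; norm_num
  have hT2 : s * Real.log l ≤ 3 * W := by
    calc s * Real.log l ≤ s * (3 * Λ) := mul_le_mul_of_nonneg_left hlogl hs0
      _ = 3 * W := by rw [hW]; ring
  have hHthrh : Hthr ≤ h := by
    have h1 : Hthr ≤ max Hthr 0 := le_max_left _ _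
    have h2 : max Hthr 0 ≤ H₁ := by rw [hH₁]; linarith
    linarith
  have hthr : (60 * delta 1) ^ 2 * Real.log (2 * delta 1 * h) / Real.sqrt h ≤ ε₁ := by
    refine hH₃ H₃ le_rfl 1 le_rfl 1 one_pos le_rfl ε₁ hε₁0 hε₁1 h ?_
    rw [hHthr] at hHthrh; exact hHthrh
  have hWle : 3600 * 552960 ^ 2 * W ≤ ε / 6 * (μ * h) := by
    rw [← hδdef, ← hs, ← hΛ, div_le_iff₀ hspos] at hthr
    have hm := mul_le_mul_of_nonneg_left hthr hs0
    calc 3600 * 552960 ^ 2 * W = s * ((60 * δ) ^ 2 * Λ) := by rw [hW, hδv]; ring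
      _ ≤ s * (ε₁ * s) := hm
      _ = ε / 6 * (μ * h) := by rw [← hs2, hε₁def]; ring
  have hX2' : 2 * (μ * X) ≤ μ * logQNotTwo P := by
    have hm := mul_le_mul_of_nonneg_left hX2 hμ0.le
    have e : μ * (2 * X) = 2 * (μ * X) := by ring
    linarith
  have hQ1' : μ * logQNotTwo P - μ * logQAvoid P {2, l} ≤ s * Real.log l := by
    have hsl : 0 ≤ s * Real.log l := mul_nonneg hs0 (Real.log_nonneg hl1)
    have e : μ * (logQNotTwo P - logQAvoid P {2, l}) = μ * logQNotTwo P - μ * logQAvoid P {2, l} := by ring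
    rcases le_or_gt 0 (logQNotTwo P - logQAvoid P {2, l}) with hpos | hneg
    · have hm := mul_le_mul_of_nonneg_right hμ1 hpos
      rw [e, one_mul] at hm
      linarith
    · have hm := mul_le_mul_of_nonneg_left hneg.le hμ0.le
      rw [e, mul_zero] at hm
      linarith
  have hh6' : μ * h ≤ 6 * (μ * X) + 10 := by
    have hm := mul_le_mul_of_nonneg_left hh6 hμ0.le
    have e : μ * (6 * X + 10) = 6 * (μ * X) + 10 * μ := by ring
    rw [e] at hm
    linarith
  have hXle := arith_core hε hε1 hR0 hη0.le hLc hl0 hX2' hQ1' hd2 h20 hlW hT2 hWle hh6'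
  have hμne : μ ≠ 0 := hμ0.ne'
  have hXdiv : X ≤ 3 / μ * (1 + ε) * R + (5 * (ε / 6) + 120 * η) / μ :=
    calc X = μ⁻¹ * (μ * X) := by rw [← mul_assoc, inv_mul_cancel₀ hμne, one_mul]
      _ ≤ μ⁻¹ * (3 * (1 + ε) * R + (5 * (ε / 6) + 120 * η)) :=
          mul_le_mul_of_nonneg_left hXle (inv_pos.mpr hμ0).le
      _ = 3 / μ * (1 + ε) * R + (5 * (ε / 6) + 120 * η) / μ := by ring
  rw [← hR, ← hX]
  linarith

/-! ## §2 Far from the cusps at `∞` and `2`: `ρ⁵·c³ ≤ (abc)_{odd}` -/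

/-- `(n)_{odd} = n·|n|_2` for `n ≠ 0`: the odd part `ordCompl[2] n = n / 2^{v₂(n)}` against Mathlib's `padicNorm 2 n = 2^{−v₂(n)}`. [folklore] -/
theorem natCast_ordCompl_two_eq_mul_padicNorm {n : ℕ} (hn : n ≠ 0) :
    ((ordCompl[2] n : ℕ) : ℝ) = (n : ℝ) * ((padicNorm 2 (n : ℚ) : ℚ) : ℝ) := by
  have hsplit : ordProj[2] n * ordCompl[2] n = n := Nat.ordProj_mul_ordCompl_eq_self n 2
  have hnorm : ((padicNorm 2 (n : ℚ) : ℚ) : ℝ) = ((2 : ℝ) ^ (n.factorization 2))⁻¹ := by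
    have hq : (n : ℚ) ≠ 0 := by exact_mod_cast hn
    rw [padicNorm.eq_zpow_of_nonzero hq, padicValRat.of_nat, ← Nat.factorization_def n Nat.prime_two, zpow_neg,
      zpow_natCast]
    push_cast
    rfl
  have h2v : (0 : ℝ) < (2 : ℝ) ^ (n.factorization 2) := by positivity
  rw [hnorm, eq_mul_inv_iff_mul_eq₀ h2v.ne']
  have hcast : ((ordCompl[2] n : ℕ) : ℝ) * ((ordProj[2] n : ℕ) : ℝ) = n := by
    rw [mul_comm]; exact_mod_cast hsplit
  have hproj : ((ordProj[2] n : ℕ) : ℝ) = (2 : ℝ) ^ (n.factorization 2) := by push_cast; rfl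
  rw [← hproj]
  exact hcast

/-- **Far from the cusps ⟹ `ρ⁵·c³ ≤ (abc)_{odd}`**: for an abc triple whose point `λ = a/c` is `ρ`-far from the cusps at `∞` and at `2`
(`0 < ρ ≤ 1/2`; by `GenEll.farFromCusps_ratPoint_triple_iff`: `ρ·c < a`, `ρ·c < b`, `ρ ≤ |a|_2, |b|_2, |c|_2`) one has `abc > ρ²·c³` and
`|abc|_2 ≥ ρ³`, so `(abc)_{odd} = abc·|abc|_2 ≥ ρ⁵·c³`. Elementary. [cite: MochizukiGenEll2010, Ex 1.3 (ii) p.5] -/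
theorem rho_pow_five_mul_cube_le_oddPart_of_farFromCusps {a b c : ℕ} (ht : IsABCTriple a b c) {ρ : ℝ} (h0 : 0 < ρ)
    (h2 : ρ ≤ 1 / 2) (hfar : (ratPoint ((a : ℚ) / c)).FarFromCusps ({2} : Finset ℕ) ρ) :
    ρ ^ 5 * (c : ℝ) ^ 3 ≤ ((ordCompl[2] (a * b * c) : ℕ) : ℝ) := by
  have hS : ∀ p ∈ ({2} : Finset ℕ), p.Prime := by
    intro p hp; rw [Finset.mem_singleton] at hp; subst hp; exact Nat.prime_two
  obtain ⟨⟨ha, hb⟩, hnon⟩ := (farFromCusps_ratPoint_triple_iff ht hS h0 (h2.trans (by norm_num))).1 hfar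
  obtain ⟨h2a, h2b, h2c⟩ := hnon 2 (Finset.mem_singleton_self 2)
  have hapos : 0 < a := ht.1
  have hbpos : 0 < b := ht.2.1
  have hcpos : 0 < c := by have := ht.2.2.1; omega
  have hn0 : a * b * c ≠ 0 := Nat.mul_ne_zero (Nat.mul_ne_zero hapos.ne' hbpos.ne') hcpos.ne'
  have hc0 : (0 : ℝ) ≤ c := Nat.cast_nonneg c
  have hρc : 0 ≤ ρ * c := mul_nonneg h0.le hc0
  have hab : ρ * c * (ρ * c) ≤ (a : ℝ) * b := mul_le_mul ha.le hb.le hρc (Nat.cast_nonneg a)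
  have habc : ρ ^ 2 * (c : ℝ) ^ 3 ≤ (a : ℝ) * b * c := by
    have := mul_le_mul_of_nonneg_right hab hc0
    calc ρ ^ 2 * (c : ℝ) ^ 3 = ρ * c * (ρ * c) * c := by ring
      _ ≤ (a : ℝ) * b * c := this
  have hnorm : ((padicNorm 2 ((a * b * c : ℕ) : ℚ) : ℚ) : ℝ) =
      ((padicNorm 2 (a : ℚ) : ℚ) : ℝ) * ((padicNorm 2 (b : ℚ) : ℚ) : ℝ) * ((padicNorm 2 (c : ℚ) : ℚ) : ℝ) := by
    push_cast
    rw [padicNorm.mul, padicNorm.mul]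
    push_cast
    ring
  have hpa0 : (0 : ℝ) ≤ ((padicNorm 2 (a : ℚ) : ℚ) : ℝ) := by exact_mod_cast padicNorm.nonneg _
  have hρ3 : ρ ^ 3 ≤ ((padicNorm 2 ((a * b * c : ℕ) : ℚ) : ℚ) : ℝ) := by
    rw [hnorm]
    have h1 : ρ * ρ ≤ ((padicNorm 2 (a : ℚ) : ℚ) : ℝ) * ((padicNorm 2 (b : ℚ) : ℚ) : ℝ) :=
      mul_le_mul h2a h2b h0.le hpa0
    calc ρ ^ 3 = ρ * ρ * ρ := by ring
      _ ≤ ((padicNorm 2 (a : ℚ) : ℚ) : ℝ) * ((padicNorm 2 (b : ℚ) : ℚ) : ℝ) * ((padicNorm 2 (c : ℚ) : ℚ) : ℝ) :=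
          mul_le_mul h1 h2c h0.le (mul_nonneg hpa0 (by exact_mod_cast padicNorm.nonneg _))
  -- `(abc)_{odd} = abc·|abc|_2`
  rw [natCast_ordCompl_two_eq_mul_padicNorm hn0]
  have habcR : ((a * b * c : ℕ) : ℝ) = (a : ℝ) * b * c := by push_cast; ring
  rw [habcR]
  calc ρ ^ 5 * (c : ℝ) ^ 3 = (ρ ^ 2 * (c : ℝ) ^ 3) * ρ ^ 3 := by ring
    _ ≤ ((a : ℝ) * b * c) * ((padicNorm 2 ((a * b * c : ℕ) : ℚ) : ℚ) : ℝ) :=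
        mul_le_mul habc hρ3 (by positivity) (by positivity)

/-! ## §3 abc with exponent `1/μ` on every far-from-cusps family -/

/-- **abc WITH EXPONENT `1/μ` ON EVERY FAR-FROM-CUSPS FAMILY from the DILATED display at the rational points** (`0 < μ ≤ 1`): for every
`0 < ρ ≤ 1/2`, `ABCWithExponentOn {P | P.FarFromCusps {2} ρ} (1/μ)` — i.e. `∀ ε > 0, ∃ C = C(ρ, ε) > 0`, `c < C·rad(abc)^{(1/μ)(1+ε)}` for all abc
triples with `min(a, b) > ρ·c` and `2^{v₂(a)}, 2^{v₂(b)}, 2^{v₂(c)} ≤ ρ⁻¹`. R19's conclusion shape (a) (EXP-SPEC §7) with `Λ = 1/μ`, at DEGREE ONE,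
TRANSFER-FREE AND CONE-FREE: §1 (`X ≤ (3/μ)(1+ε)R + C`) and §2 (`3·log c ≤ X + 5·log ρ⁻¹`). CONDITIONAL on the display binder; nothing asserted;
no side taken. [cite: Mochizuki2012, IUTchIV Cor. 2.2 (ii) pp. 41–48] [cite: MochizukiGenEll2010, Thm 2.1 p.12] [claim: Mochizuki2012, status: disputed] -/
theorem abcExpOn_farFromCusps_of_dilatedDisplay_degOne {μ : ℝ} (hμ0 : 0 < μ) (hμ1 : μ ≤ 1)
    (hdisp : ∀ η : ℝ, IsEtaPrm η → ∀ P : NFPoint, P ∈ UP → P.degree ≤ 1 → ∀ l : ℕ, l.Prime → 5 ≤ l →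
      AdmitsCore P → CondP2 P l → CondP5 P l → CondP6 P l →
      1 / 6 * (μ * logQAvoid P {2, l}) ≤
        (1 + 20 * (dmod P : ℝ) / l) * (P.logDiff + logCondAvoid P {2, l})
          + 20 * (2 ^ 12 * 3 ^ 3 * 5 * (dmod P : ℝ) * l + η))
    {ρ : ℝ} (h0 : 0 < ρ) (h2 : ρ ≤ 1 / 2) :
    ABCWithExponentOn {P : NFPoint | P.FarFromCusps ({2} : Finset ℕ) ρ} (1 / μ) := by
  intro ε hε
  -- work with `ε' = min(ε,1)`
  set ε' : ℝ := min ε 1 with hε'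
  have hε'0 : 0 < ε' := lt_min hε one_pos
  have hε'1 : ε' ≤ 1 := min_le_right ε 1
  have hε'ε : ε' ≤ ε := min_le_left ε 1
  obtain ⟨C, hC⟩ := log_oddPart_le_of_dilatedDisplay_degOne hμ0 hμ1 hdisp hε'0 hε'1
  -- the constant: `log c ≤ (1/μ)(1+ε)·log rad + (C + 5·log ρ⁻¹)/3`
  set K : ℝ := (C + 5 * Real.log ρ⁻¹) / 3 with hK
  refine ⟨Real.exp K + 1, by positivity, fun a b c ht hmem => ?_⟩
  have hfar : (ratPoint ((a : ℚ) / c)).FarFromCusps ({2} : Finset ℕ) ρ := hmem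
  have hX := hC a b c ht
  have hcube := rho_pow_five_mul_cube_le_oddPart_of_farFromCusps ht h0 h2 hfar
  have hcpos : 0 < c := by have := ht.2.2.1; have := ht.1; omega
  have hc0 : (0 : ℝ) < c := by exact_mod_cast hcpos
  have hrad : 0 < rad a b c := by rw [rad_def]; exact Nat.pos_of_ne_zero UniqueFactorizationMonoid.radical_ne_zero
  have hr0 : (0 : ℝ) < (rad a b c : ℝ) := by exact_mod_cast hrad
  have hr1 : (1 : ℝ) ≤ (rad a b c : ℝ) := by exact_mod_cast hrad
  have hR0 : 0 ≤ Real.log (rad a b c) := Real.log_nonneg hr1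
  -- `3·log c + 5·log ρ ≤ X`
  have hodd0 : 0 < ρ ^ 5 * (c : ℝ) ^ 3 := by positivity
  have hlog3 : 5 * Real.log ρ + 3 * Real.log c ≤ Real.log ((ordCompl[2] (a * b * c) : ℕ) : ℝ) := by
    have h := Real.log_le_log hodd0 hcube
    rw [Real.log_mul (by positivity) (by positivity), Real.log_pow, Real.log_pow] at h
    push_cast at h
    linarith
  have hlogρ : Real.log ρ⁻¹ = -Real.log ρ := Real.log_inv ρ
  -- `(1/μ)(1+ε')·R ≤ (1/μ)(1+ε)·R`
  have hmono : 1 / μ * (1 + ε') * Real.log (rad a b c) ≤ 1 / μ * (1 + ε) * Real.log (rad a b c) := by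
    apply mul_le_mul_of_nonneg_right _ hR0
    exact mul_le_mul_of_nonneg_left (by linarith) (by positivity)
  have hle : Real.log c ≤ 1 / μ * (1 + ε) * Real.log (rad a b c) + K := by
    have e3 : 3 / μ * (1 + ε') * Real.log (rad a b c) = 3 * (1 / μ * (1 + ε') * Real.log (rad a b c)) := by ring
    rw [hK, hlogρ]
    rw [e3] at hX
    linarith
  have hexp : (c : ℝ) ≤ Real.exp K * (rad a b c : ℝ) ^ (1 / μ * (1 + ε)) := by
    have h1 : (c : ℝ) = Real.exp (Real.log c) := (Real.exp_log hc0).symm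
    have h2' : ((rad a b c : ℕ) : ℝ) ^ (1 / μ * (1 + ε)) = Real.exp ((1 / μ * (1 + ε)) * Real.log (rad a b c)) := by
      rw [Real.rpow_def_of_pos hr0, mul_comm]
    rw [h1, h2', ← Real.exp_add]
    exact Real.exp_le_exp.mpr (by linarith)
  have hpow : 0 < (rad a b c : ℝ) ^ (1 / μ * (1 + ε)) := Real.rpow_pos_of_pos hr0 _
  calc (c : ℝ) ≤ Real.exp K * (rad a b c : ℝ) ^ (1 / μ * (1 + ε)) := hexp
    _ < (Real.exp K + 1) * (rad a b c : ℝ) ^ (1 / μ * (1 + ε)) := by nlinarith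

end Summit.ABC.IUTFork.Repair.RH.OffSigma

end
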